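import Summits.QuantumFields.YangMills.Theorems.LuscherReductionTwistedTraceScalingTrackDefs
import Summits.QuantumFields.YangMills.Theorems.LuscherReductionTwistedTraceScalingTrackRun
import Summits.QuantumFields.YangMills.Theorems.LuscherReductionTwistedTraceScalingTrackLemmas
import Summits.QuantumFields.YangMills.Theorems.LuscherReductionTwistedTraceScalingBaseWindow
import Summits.QuantumFields.YangMills.Theorems.LuscherReductionRunningReductionBOHandoverLabels
import HarnessLib

/-!
# Registered stub TRACK `stub_labelTracking : Stmt.stub_labelTracking` of line «twolattice» skeleton rev 3 (crux `TwistedTraceScaling`,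
# stmt-QuantumFields-20203) — BY NAME AND SIGNATURE, unconditional: the tree's two-loop label tracks every two-loop flow to relative accuracy `o(1)`

Route `LuscherReduction` (owner ym-beyond-p1), crux `TwistedTraceScaling` (stmt-QuantumFields-20203), line «twolattice», skeleton rev 3 «two-loop calibration»
(owner g29, `pub/ym-beyond/p1-g29-files/Lines-twolattice-r3.lean`, sha16 1a2ae9b1ae61a9c5, registered 2026-08-27T15:26Z; stubs S-BASE · CMP-2LOOP · TRACK;
director-ym №133 Q4).  LEAD ym-lead-20203-twolattice g1.  The gate credits the VERBATIM header `theorem stub_labelTracking : Stmt.stub_labelTracking := …`; the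
statement abbreviation and the §0 vocabulary (`Stmt.twoLoopLawH`, `twoLoopStepBal`, `bareBal`, `flowInvSq`, `calLambda`) are re-homed character for character in
`…TwistedTraceScalingTrackDefs` (p544847), so the owner's discharge in the skeleton is `theorem stub_labelTracking : Stmt.stub_labelTracking :=
Summit.QuantumFields.YangMills.Theorems.FemtoTransferGap.TwoLattice.stub_labelTracking` (the two `Stmt.*`/§0 families are syntactically identical under the same
`open`s).

TRACK: for every block factor `M ≥ 2`, tolerance `δ > 0`, femto time `s > 0` and family `φ` with `Stmt.twoLoopLawH (stepBal 2 M) (twoLoopStepBal M) φ` there is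
`lam1 > 0` such that in the femto windows at `lam ≤ lam1`, on every E1 pair with `1 ≤ β₁` and equal labels `invRunningCoupling β₁ b = invRunningCoupling β L`:
(i) `1/(4lam³) ≤ flowInvSq φ β (k+1)`, (ii) `|flowInvSq φ β (k+1) − 2β₁| ≤ δ·2β₁`, (iii) `|femtoSteps s β L · calLambda φ β (k+1) b / L − s| ≤ δ`.

PROOF.  Unpack `twoLoopLawH` (split `S`, constants `γ, C₁, c₀, θ₀, C₃, c₁, θ₁`; the eventual lower bound is not needed: the two-loop form already bounds the
decrements below); `a = stepBal 2 M = 8b₀ log M`, `κ = twoLoopStepBal M / a = 4b₁/b₀` (`Track.kappa_eq`); derived constants `G, g_m, R, m, B_c, C₂` of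
`TowerFlow.run_control`, `E₀ = κC₂ + R`, `C' = κ(C₂ + a/m) + R`, `C_ii = 4b₀ + E₀`, `C_w = b₀ + E₀/4`; threshold
`lam1 = min 1 (min (δ/(1 + 16 s C_w)) (1/(4 X_tot)))`, `X_tot = m + B_c + 1/g_m² + 4b₀ + C' + 2κ + C_ii/δ + 4C_w + 1`.  In a window at `lam ≤ lam1` put
`X = 1/(4lam³) ≥ X_tot` and `v = invRunningCoupling β L`; `Track.window_facts`: `v ≥ 1/(8lam³) = X/2`, `Λ³ = 1/v`, `2β ≥ 4v` (uses `1 ≤ β`).  The label identity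
`2β = 4v + 8b₀ log L − κ log(2b₀/β)` (`BOHandover.invRunningCoupling_eq`), `(k+1) log M ≤ log L` (`Track.tower_logs`) and the budget bracket
(`Track.log_bracket_budget`, `X ≥ 4b₀`) give the BUDGET of `run_control` with datum `1/bareBal β² = 2β` and horizon `k+1`; `run_control` then yields the floor
`x̂ ≥ X` = (i) and the endpoint `|x̂ − (2β − 8b₀(k+1)log M − κ log(2β/x̂))| ≤ E₀`.  (ii) is `Track.clause_ii` (equal labels; `2β₁ ≥ 4v ≥ 2X` uses `1 ≤ β₁` —
the weak-root selection demanded by the Disproof's `towerE1_false_without_beta1GeOne_of_base`), absolute error `2C_ii ≤ δ·2β₁` since `2β₁ ≥ 2X ≥ 2C_ii/δ`.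
(iii): `Track.clause_iii_label` puts the calibrated label `w = invRunningCoupling (x̂/2) b` within `C_w` of `v`; `Track.clause_iii_cube` turns `Λ³ = 1/v`,
`Λ'³ = 1/w` into `|Λ'/Λ − 1| ≤ 2C_w/v ≤ 16 C_w lam`; `Base.femtoSteps_mul_unit` and `Λ/L ≤ lam/2` (`L ≥ M² ≥ 4`) give `|T Λ'/L − s| ≤ lam(1 + 16 s C_w) ≤ δ`
(`Track.clause_iii_time`).  All thresholds depend on `(M, δ, s)` and the constants of `φ` only.

HONEST FRAMING: pure real analysis about hypothetical two-loop flow families and the tree's two-loop label (W-FLOW for Bałaban's true flow and CMP-2LOOP remain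
OPEN, not in print); closes ONE of the three registered stubs of skeleton r3 on the conditional femto rung R2b1; nothing here bears on infinite volume, a
mass gap, or Clay.  No definitions, no new named facts.
-/

set_option autoImplicit false

noncomputable section

open Real
open scoped BigOperators

namespace Summit.QuantumFields.YangMills.Theorems.FemtoTransferGap.TwoLattice

open Summit.QuantumFields.YangMills.Theorems.FemtoTransferGap
open Summit.QuantumFields.YangMills.Theorems.FemtoTransferGap.TraceDoor
open Literature.MathematicalPhysics.QuantumFieldTheory.Balaban1983to89

/-- The calibrated femto parameter is positive when its label is. [folklore] -/
theorem Track.luscherLambda_pos_of_inv_pos {β : ℝ} {L : ℕ} (h : 0 < invRunningCoupling β L) : 0 < luscherLambda β L := by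
  unfold luscherLambda
  rw [max_eq_left h.le]
  exact Real.rpow_pos_of_pos h _

set_option maxHeartbeats 400000 in
/-- ★ **Registered stub TRACK of line «twolattice» (skeleton rev 3), BY NAME, unconditional**: in the femto windows the tree's two-loop label
`invRunningCoupling` tracks every two-loop flow family `φ` (`Stmt.twoLoopLawH (stepBal 2 M) (twoLoopStepBal M) φ`) to relative accuracy `o(1)` — label
matching on an E1 pair delivers the three calibrated hypotheses of CMP-2LOOP.  Proof: module docstring (run control `TowerFlow.run_control` with the budget from
the label identity; clauses by `Track.clause_ii`, `Track.clause_iii_label/cube/time`). [cite: Balaban1987RG1, (0.18)–(0.20) pp.255–256, Thm 2 p.259]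
[cite: LuscherWeiszWolff1991, §2] [cite: MontvayMunster1994, (5.66) §5.1] [cite: Rivasseau1991, Lemma II.5.4] -/
theorem stub_labelTracking : Stmt.stub_labelTracking := by
  intro M hM δ hδ s hs φ hφ
  obtain ⟨S, γ, blow, C₁, c₀, θ₀, C₃, c₁, θ₁, k₀, hγ, _hblow, hC₁, hc₀, hθ₀, hθ₀1, hC₃, hc₁, hθ₁, hθ₁1, _hEv, hAF0, hAF1, hTL⟩ := hφ
  -- units (the family's `binf`, `b1inf` are the tree's `stepBal 2 M`, `twoLoopStepBal M`)
  have hb0 : 0 < b0 := by unfold b0; positivity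
  have hb1 : 0 < b1 := by unfold b1; positivity
  have hM1 : (1 : ℝ) < M := by exact_mod_cast (lt_of_lt_of_le (by norm_num) hM : 1 < M)
  have hlogM : 0 < Real.log (M : ℝ) := Real.log_pos hM1
  set a : ℝ := B12Normalization.stepBal 2 (M : ℝ) with ha_def
  have ha8 : a = 8 * b0 * Real.log M := Track.stepBal_two_eq M
  have ha : 0 < a := by rw [ha8]; positivity
  set b1inf : ℝ := twoLoopStepBal M with hb1inf_def
  have hb1inf : 0 ≤ b1inf := by rw [hb1inf_def]; unfold twoLoopStepBal; positivity
  obtain ⟨κ, hκ⟩ : ∃ κ : ℝ, κ = b1inf / a := ⟨_, rfl⟩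
  have hκ4 : κ = 4 * b1 / b0 := by rw [hκ]; exact Track.kappa_eq hM
  have hκ0 : 0 ≤ κ := by rw [hκ4]; positivity
  -- derived constants of the run control
  obtain ⟨G, hG⟩ : ∃ t : ℝ, t = c₀ / (1 - θ₀) + c₁ / (1 - θ₁) := ⟨_, rfl⟩
  obtain ⟨gm, hgm⟩ : ∃ t : ℝ, t = min (min γ 1) (a / (8 * (C₃ + 1))) := ⟨_, rfl⟩
  obtain ⟨R, hR⟩ : ∃ t : ℝ, t = G + C₃ * (4 / a * (1 + 2 * G)) := ⟨_, rfl⟩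
  obtain ⟨m, hm⟩ : ∃ t : ℝ, t = max 1 (2 * (a + b1inf + R)) := ⟨_, rfl⟩
  obtain ⟨Bc, hBc⟩ : ∃ t : ℝ, t = a + c₀ + C₁ * γ := ⟨_, rfl⟩
  obtain ⟨C₂, hC₂⟩ : ∃ t : ℝ, t = (κ * a + m ^ 2 / 2) * ((1 / m + 2 * R / m ^ 2) / a) + R / m := ⟨_, rfl⟩
  have hG0 : 0 ≤ G := by rw [hG]; exact add_nonneg (div_nonneg hc₀ (by linarith)) (div_nonneg hc₁ (by linarith))
  have hgmpos : 0 < gm := by rw [hgm]; exact lt_min (lt_min hγ one_pos) (by positivity)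
  have hR0 : 0 ≤ R := by rw [hR]; positivity
  have hm1 : 1 ≤ m := by rw [hm]; exact le_max_left _ _
  have hmpos : 0 < m := by linarith
  have hBc0 : 0 < Bc := by rw [hBc]; positivity
  have hC₂0 : 0 ≤ C₂ := by rw [hC₂]; positivity
  obtain ⟨E₀, hE₀⟩ : ∃ t : ℝ, t = κ * C₂ + R := ⟨_, rfl⟩
  have hE₀0 : 0 ≤ E₀ := by rw [hE₀]; positivity
  obtain ⟨C', hC'⟩ : ∃ t : ℝ, t = κ * (C₂ + a / m) + R := ⟨_, rfl⟩
  have hC'0 : 0 ≤ C' := by rw [hC']; positivity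
  obtain ⟨Cw, hCw⟩ : ∃ t : ℝ, t = b0 + E₀ / 4 := ⟨_, rfl⟩
  have hCw0 : 0 < Cw := by rw [hCw]; positivity
  obtain ⟨Xtot, hXtot⟩ : ∃ t : ℝ, t = m + Bc + 1 / gm ^ 2 + 4 * b0 + C' + 2 * κ + (4 * b0 + E₀) / δ + 4 * Cw + 1 := ⟨_, rfl⟩
  have hgm2 : 0 ≤ 1 / gm ^ 2 := by positivity
  have hiiδ : 0 ≤ (4 * b0 + E₀) / δ := by positivity
  have hXtotpos : 0 < Xtot := by rw [hXtot]; linarith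
  -- the threshold
  refine ⟨min 1 (min (δ / (1 + 16 * s * Cw)) (1 / (4 * Xtot))), lt_min one_pos (lt_min (by positivity) (by positivity)), ?_⟩
  intro lam hlam hle L _ hL β hW b k _ hMb hbM hbL hLb β₁ hβ₁ hmatch
  have hl1 : lam ≤ 1 := hle.trans (min_le_left _ _)
  have hlδ : lam ≤ δ / (1 + 16 * s * Cw) := hle.trans ((min_le_right _ _).trans (min_le_left _ _))
  have hlX : lam ≤ 1 / (4 * Xtot) := hle.trans ((min_le_right _ _).trans (min_le_right _ _))
  -- the floor `X = 1/(4 lam³) ≥ Xtot`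
  obtain ⟨X, hX⟩ : ∃ t : ℝ, t = 1 / (4 * lam ^ 3) := ⟨_, rfl⟩
  have hXpos : 0 < X := by rw [hX]; positivity
  have hlam3 : lam ^ 3 ≤ lam := by
    calc lam ^ 3 ≤ lam ^ 1 := pow_le_pow_of_le_one hlam.le hl1 (by norm_num)
      _ = lam := pow_one lam
  have hXge : Xtot ≤ X := by
    rw [hX, le_div_iff₀ (by positivity)]
    have h1 : lam * (4 * Xtot) ≤ 1 := by rwa [le_div_iff₀ (by positivity)] at hlX
    have h2 := mul_le_mul_of_nonneg_left hlam3 (by positivity : (0 : ℝ) ≤ 4 * Xtot)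
    linarith
  rw [hXtot] at hXge
  have hX_m : m + Bc ≤ X := by linarith
  have hX_box : 1 / gm ^ 2 + Bc ≤ X := by linarith
  have hX_4b0 : 4 * b0 ≤ X := by linarith
  have hX_C' : C' ≤ X := by linarith
  have hX_κ : 2 * κ ≤ X := by linarith
  have hX_ii : (4 * b0 + E₀) / δ ≤ X := by linarith
  have hX_w : 4 * Cw + 1 ≤ X := by linarith
  -- window facts
  obtain ⟨hv, hΛ3, hv8, hvβ⟩ := Track.window_facts hlam hW
  obtain ⟨v, hvdef⟩ : ∃ t : ℝ, t = invRunningCoupling β L := ⟨_, rfl⟩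
  rw [← hvdef] at hv hΛ3 hv8 hvβ
  have hvX : X ≤ 2 * v := by
    have : X = 2 * (1 / (8 * lam ^ 3)) := by rw [hX]; field_simp; ring
    rw [this]; linarith
  have hβ1 : 1 ≤ β := hW.1
  have hβpos : 0 < β := by linarith
  have hβ₁pos : 0 < β₁ := by linarith
  -- label identities (two-loop label, tree `BOHandover.invRunningCoupling_eq`)
  have h2β : 2 * β = 4 * v + 8 * b0 * Real.log (L : ℝ) - κ * Real.log (2 * b0 / β) := by
    have h := BOHandover.invRunningCoupling_eq β L
    rw [← hvdef] at h
    rw [hκ4]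
    linear_combination (-4) * h
  have h2β₁ : 2 * β₁ = 4 * v + 8 * b0 * Real.log (b : ℝ) - κ * Real.log (2 * b0 / β₁) := by
    have h := BOHandover.invRunningCoupling_eq β₁ b
    rw [hmatch, ← hvdef] at h
    rw [hκ4]
    linear_combination (-4) * h
  have h2β₁v : 4 * v ≤ 2 * β₁ := by
    have := BOHandover.invRunningCoupling_le_half hβ₁ b
    rw [hmatch, ← hvdef] at this; linarith
  -- tower logarithms
  have hbone : 1 ≤ b := NeZero.one_le
  obtain ⟨hθ0, hθ1, hAL⟩ := Track.tower_logs hM hbone hbL hLb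
  -- the budget of the run control (floor `X`, horizon `k+1`, datum `2β`)
  have hg0 : 0 < bareBal β := Track.bareBal_pos hβpos
  have hx0eq : 1 / bareBal β ^ 2 = 2 * β := Track.one_div_bareBal_sq hβpos
  have haK : a * (((k + 1 : ℕ)) : ℝ) = 8 * b0 * (((k : ℝ) + 1) * Real.log (M : ℝ)) := by
    rw [ha8]; push_cast; ring
  have hx0X : X ≤ 1 / bareBal β ^ 2 := by rw [hx0eq]; linarith
  have hbud : X ≤ 1 / bareBal β ^ 2 - a * (((k + 1 : ℕ)) : ℝ) -
      κ * (Real.log ((1 / bareBal β ^ 2) / X) + C₂ + a / m) - R := by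
    rw [hx0eq, haK]
    have hbr := Track.log_bracket_budget hβpos hXpos
    have hbrκ : κ * Real.log (2 * b0 / β) + κ * Real.log (2 * β / X) = κ * Real.log (4 * b0) - κ * Real.log X := by
      linear_combination (-κ) * hbr
    have hlog4 : Real.log (4 * b0) ≤ Real.log X := Real.log_le_log (by positivity) hX_4b0
    have hk1 : κ * Real.log (4 * b0) ≤ κ * Real.log X := mul_le_mul_of_nonneg_left hlog4 hκ0
    have hk2 : 8 * b0 * (((k : ℝ) + 1) * Real.log (M : ℝ)) ≤ 8 * b0 * Real.log (L : ℝ) :=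
      mul_le_mul_of_nonneg_left hAL (by positivity)
    have hsplit : κ * (Real.log (2 * β / X) + C₂ + a / m) = κ * Real.log (2 * β / X) + (κ * (C₂ + a / m) + R) - R := by ring
    rw [hsplit, ← hC']
    linarith
  -- run control
  obtain ⟨hfl, _hid, hend⟩ := TowerFlow.run_control S hγ ha hb1inf hC₁ hc₀ hθ₀ hθ₀1 hC₃ hc₁ hθ₁ hθ₁1 hAF0 hAF1 hTL
    hκ hG hgm hR hm hBc hC₂ hg0 hX_m hX_box hx0X hbud
  -- the calibrator at the horizon
  obtain ⟨x, hxdef⟩ : ∃ t : ℝ, t = flowInvSq φ β (k + 1) := ⟨_, rfl⟩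
  have hxg : x = 1 / FlowStepRuns.genSeq φ (bareBal β) (k + 1) ^ 2 := by rw [hxdef]; rfl
  have hxX : X ≤ x := by rw [hxg]; exact (hfl (k + 1) le_rfl).2
  have hxpos : 0 < x := lt_of_lt_of_le hXpos hxX
  -- the two-loop endpoint estimate in the label's atoms
  have hend' : |x - (2 * β - 8 * b0 * (((k : ℝ) + 1) * Real.log (M : ℝ)) - κ * Real.log (2 * β / x))| ≤ E₀ := by
    rw [hE₀, hxg, ← hx0eq, ← haK]
    exact hend
  refine ⟨?_, ?_, ?_⟩
  · -- (i) the floor at the horizon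
    rw [← hX, ← hxdef]; exact hxX
  · -- (ii) coupling: absolute `2(4b₀ + E₀)`, relative `δ` since `2β₁ ≥ 4v ≥ 2X ≥ 2(4b₀+E₀)/δ`
    have hii := Track.clause_ii hκ0 hxpos hβpos hβ₁pos h2β h2β₁ hθ0 hθ1 hend' (hX_κ.trans hxX) (by linarith)
    rw [← hxdef]
    refine hii.trans ?_
    have h1 : 4 * b0 + E₀ ≤ X * δ := (div_le_iff₀ hδ).1 hX_ii
    have h2 : X * δ ≤ β₁ * δ := mul_le_mul_of_nonneg_right (by linarith) hδ.le
    linarith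
  · -- (iii) femto time in calibrated units
    rw [hκ4] at h2β hend'
    have hlab := Track.clause_iii_label hxpos hβpos h2β hθ0 hθ1 hend'
    obtain ⟨w, hwdef⟩ : ∃ t : ℝ, t = invRunningCoupling (x / 2) b := ⟨_, rfl⟩
    have hweq : w = x / 4 - 2 * b0 * Real.log (b : ℝ) + (b1 / b0) * Real.log (2 * b0 / (x / 2)) := by
      rw [hwdef, BOHandover.invRunningCoupling_eq]; ring
    have hwv : |w - v| ≤ Cw := by rw [hweq, hCw]; exact hlab
    have hvC : 2 * Cw ≤ v := by linarith
    have hwpos : 0 < w := by have := (abs_le.1 hwv).1; linarith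
    have hwpos' : 0 < invRunningCoupling (x / 2) b := by rw [← hwdef]; exact hwpos
    have hΛpos : 0 < luscherLambda β L := luscherLambda_pos_of_window hlam hW
    have hcalpos : 0 < luscherLambda (x / 2) b := Track.luscherLambda_pos_of_inv_pos hwpos'
    have hcal3 : luscherLambda (x / 2) b ^ 3 = w⁻¹ := by rw [hwdef]; exact BOHandover.luscherLambda_pow_three hwpos'
    have hρ := Track.clause_iii_cube hv hwpos hΛpos hcalpos hΛ3 hcal3 hwv hvC
    have hη1 : 2 * Cw / v ≤ 1 := by rw [div_le_one hv]; linarith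
    -- `2C_w/v ≤ 16 C_w lam` (from `v ≥ 1/(8lam³)` and `lam ≤ 1`)
    have hlv : 1 / 8 ≤ lam * v := by
      have h1 : lam * (1 / (8 * lam ^ 3)) = 1 / (8 * lam ^ 2) := by field_simp
      have h2 : 1 / 8 ≤ 1 / (8 * lam ^ 2) := by
        apply div_le_div_of_nonneg_left (by norm_num) (by positivity)
        have : lam ^ 2 ≤ 1 := pow_le_one₀ hlam.le hl1
        linarith
      have h3 : lam * (1 / (8 * lam ^ 3)) ≤ lam * v := mul_le_mul_of_nonneg_left hv8 hlam.le
      linarith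
    have hηlam : 2 * Cw / v ≤ 16 * Cw * lam := by
      rw [div_le_iff₀ hv]
      have : 16 * Cw * lam * v = 16 * Cw * (lam * v) := by ring
      rw [this]
      have := mul_le_mul_of_nonneg_left hlv (by positivity : (0 : ℝ) ≤ 16 * Cw)
      linarith
    -- time bookkeeping
    obtain ⟨hT1, hT2⟩ := Base.femtoSteps_mul_unit (L1 := L) hs.le hlam hW
    have hLpos : (0 : ℝ) < L := by exact_mod_cast Nat.pos_of_ne_zero (NeZero.ne L)
    have hL4 : (4 : ℝ) ≤ L := by
      have : 4 ≤ L := le_trans (Nat.pow_le_pow_left hM 2) hL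
      exact_mod_cast this
    have hΛL : luscherLambda β L / L ≤ lam / 2 := by
      rw [div_le_iff₀ hLpos]
      have := mul_le_mul_of_nonneg_left hL4 (by positivity : (0 : ℝ) ≤ lam / 2)
      linarith [hW.2.2]
    have htime := Track.clause_iii_time hs.le hLpos hΛpos hT1 hT2 hΛL hρ hη1
    have hcal : calLambda φ β (k + 1) b = luscherLambda (x / 2) b := by rw [hxdef]; rfl
    rw [hcal]
    refine htime.trans ?_
    have hfin : lam * (1 + 16 * s * Cw) ≤ δ := by rwa [le_div_iff₀ (by positivity)] at hlδ
    have hsη : s * (2 * Cw / v) ≤ s * (16 * Cw * lam) := mul_le_mul_of_nonneg_left hηlam hs.le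
    linarith

end Summit.QuantumFields.YangMills.Theorems.FemtoTransferGap.TwoLattice

end
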